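import Summits.Schanuel.Schanuel.Theorems.SoloInformedX193Demand

/-!
# X193 kernel line, file F7b: the supply side of the count, one level at a time

Solo seat `solo-Schanuel-informed`, X193 kernel programme (design note
`work/s213/X193-KERNEL-DESIGN.md`, Amendments A4-A7; pen proof `work/s194/X193-pen.md` §5
(b') and its Corollary; files F5 = `SoloInformedX193EntryFare`,
F5b = `SoloInformedX193Window`, F7a = `SoloInformedX193Lives`, F7c = `SoloInformedX193Demand`).

Pen §7 double-counts the incidences (column `k ≤ K`, level `n` in a window of levels)
served by a CHEAP CAPPED main server `P = srv k` (hypothesis (H6) of file F7a, unpacked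
into the good columns `G ⊆ [1, K]` of a level and their servers `srv`).  This file treats
ONE level.  For a good column `k` (`good_fibre`, `good_server`, `good_window_upper`,
`good_window_lower`): the current life of its server entered at a level `e = ℓ + 1 > E₀`
(file F5 (loc), here `good_entry`); its fibre `S` (the good columns with the same server)
has `|S| ℓ^ν ≤ 2 C_P(ℓ)` (`fibre_supply`: case (b') of the entry-fare dichotomy of file
F5 with `t = 2`, the error of the entry law being absorbed by the hypothesis
`16 A₂ ℓ^{2-β} log (ℓ+2) ≤ 1` for `ℓ ≥ E₀`, the columns `k ≤ K ≤ E₀^σ` being active at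
the level `ℓ`, `soloX_active_of_le`); and the level lies in the window of the life:
`ℓ ≤ r n` whenever `2η ≤ r^{ν-1}` (`fibre_window_upper`, file F5b `window_upper`), and
`λ n ℓ^{ν-1} ≤ 2η U(e)` with the cap bound `U(e) = 2 e (e^β + b₁ e) + B e² log M`,
`M ≥ n + 2` (`fibre_window_lower`, file F5b `window_lower` and file F5 `cap_le_entry`).
The pure real lemmas `soloX_capBound_pos`, `soloX_capBound_le`, `soloX_window_ratio_le`
(`U(ℓ+1) / ℓ^ν ≤ (2 + 2b₁ + B log M) 2^{1+β} M^δ` for `ν + δ = 1 + β`) and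
`soloX_log_ratio_le` (`1 + log (…) ≤ 3 + β + 2b₁ + (B+δ) log M`) are the bookkeeping of
the harmonic mass `Σ 1/n ≤ 1/ℓ + log ((2η U(e)/λ ℓ^{ν-1}) / ℓ)` of a life over this
window (file F7c `soloX_harmonic_le_of_bounds`), summed over the lives in the next file.
All absorptions (`E₀`, `t = 2`) are hypotheses discharged by the counting file.  No defs.
-/

namespace Summit.Schanuel.Schanuel.Theorems
/-! ### Pure real bookkeeping of the window of a cheap life -/

/-- Columns `k ≤ K` with `K ≤ E₀^σ` are active (`k ≤ ℓ^σ`) at every level `ℓ ≥ E₀`. -/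
theorem soloX_active_of_le {σ : ℝ} (hσ : 0 ≤ σ) {K E₀ ℓ : ℕ} (hK : (K : ℝ) ≤ (E₀ : ℝ) ^ σ)
    (hℓ : E₀ ≤ ℓ) (S : Finset ℕ) (hS : ∀ k ∈ S, 1 ≤ k ∧ k ≤ K) :
    ∀ k ∈ S, 1 ≤ k ∧ (k : ℝ) ≤ (ℓ : ℝ) ^ σ := by
  intro k hk
  obtain ⟨h1, h2⟩ := hS k hk
  refine ⟨h1, ?_⟩
  have h3 : (E₀ : ℝ) ^ σ ≤ (ℓ : ℝ) ^ σ :=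
    Real.rpow_le_rpow (Nat.cast_nonneg _) (by exact_mod_cast hℓ) hσ
  calc (k : ℝ) ≤ K := by exact_mod_cast h2
    _ ≤ (ℓ : ℝ) ^ σ := hK.trans h3

/-- The cap bound `U(e) = 2 e (e^β + b₁ e) + B e² log M` of a life with entry `e ≥ 1`
(file F5 `cap_le_entry`, with `log (n+2) ≤ log M`) is positive. -/
theorem soloX_capBound_pos {β b₁ B M e : ℝ} (hb₁ : 0 ≤ b₁) (hB : 0 ≤ B) (hM : 1 ≤ M)
    (he : 1 ≤ e) : 0 < 2 * e * (e ^ β + b₁ * e) + B * e ^ 2 * Real.log M := by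
  have he0 : 0 < e := by linarith
  have hlog : 0 ≤ Real.log M := Real.log_nonneg hM
  have h1 : 0 < e ^ β := Real.rpow_pos_of_pos he0 β
  have h2 : 0 ≤ B * e ^ 2 * Real.log M := mul_nonneg (mul_nonneg hB (sq_nonneg e)) hlog
  nlinarith [mul_pos (by linarith : (0 : ℝ) < 2 * e) h1, mul_nonneg hb₁ (sq_nonneg e)]

/-- `U(e) ≤ (2 + 2 b₁ + B log M) e^{1+β}` for `e ≥ 1`, `β ≥ 1`, `M ≥ 1`. -/
theorem soloX_capBound_le {β b₁ B M e : ℝ} (hβ : 1 ≤ β) (hb₁ : 0 ≤ b₁) (hB : 0 ≤ B)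
    (hM : 1 ≤ M) (he : 1 ≤ e) :
    2 * e * (e ^ β + b₁ * e) + B * e ^ 2 * Real.log M ≤
      (2 + 2 * b₁ + B * Real.log M) * e ^ (1 + β) := by
  have he0 : 0 < e := by linarith
  have hlog : 0 ≤ Real.log M := Real.log_nonneg hM
  have e1 : e ^ (1 + β) = e * e ^ β := by rw [Real.rpow_add he0, Real.rpow_one]
  have hsq : e ^ 2 ≤ e ^ (1 + β) := by
    have := Real.rpow_le_rpow_of_exponent_le he (by linarith : (2 : ℝ) ≤ 1 + β)
    rwa [Real.rpow_two] at this
  rw [e1] at hsq ⊢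
  have h1 : b₁ * e ^ 2 ≤ b₁ * (e * e ^ β) := mul_le_mul_of_nonneg_left hsq hb₁
  have h2 : B * Real.log M * e ^ 2 ≤ B * Real.log M * (e * e ^ β) :=
    mul_le_mul_of_nonneg_left hsq (mul_nonneg hB hlog)
  nlinarith

/-- The window ratio of a cheap life with entry `e = ℓ + 1`, `1 ≤ ℓ ≤ M`:
`U(e) / ℓ^ν ≤ (2 + 2 b₁ + B log M) 2^{1+β} M^δ` where `ν + δ = 1 + β`, `δ ≥ 0`
(`(ℓ+1)^{1+β} ≤ 2^{1+β} ℓ^ν ℓ^δ`). -/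
theorem soloX_window_ratio_le {β b₁ B M ν δ ℓ : ℝ} (hβ : 1 ≤ β) (hb₁ : 0 ≤ b₁)
    (hB : 0 ≤ B) (hδ : 0 ≤ δ) (hνδ : ν + δ = 1 + β) (hℓ : 1 ≤ ℓ) (hℓM : ℓ ≤ M) :
    (2 * (ℓ + 1) * ((ℓ + 1) ^ β + b₁ * (ℓ + 1)) + B * (ℓ + 1) ^ 2 * Real.log M) /
        ℓ ^ ν ≤ (2 + 2 * b₁ + B * Real.log M) * 2 ^ (1 + β) * M ^ δ := by
  have hM : 1 ≤ M := hℓ.trans hℓM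
  have hℓ0 : 0 < ℓ := by linarith
  have hlog : 0 ≤ Real.log M := Real.log_nonneg hM
  have hKc : 0 ≤ 2 + 2 * b₁ + B * Real.log M := by nlinarith [mul_nonneg hB hlog]
  have h1 := soloX_capBound_le hβ hb₁ hB hM (by linarith : (1 : ℝ) ≤ ℓ + 1)
  have hsplit : ℓ ^ (1 + β) = ℓ ^ ν * ℓ ^ δ := by rw [← hνδ, Real.rpow_add hℓ0]
  have h2 : (ℓ + 1) ^ (1 + β) ≤ (2 : ℝ) ^ (1 + β) * (ℓ ^ ν * ℓ ^ δ) := by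
    have h : (ℓ + 1) ^ (1 + β) ≤ (2 * ℓ) ^ (1 + β) :=
      Real.rpow_le_rpow (by linarith) (by linarith) (by linarith)
    rwa [Real.mul_rpow (by norm_num) hℓ0.le, hsplit] at h
  have h3 : ℓ ^ δ ≤ M ^ δ := Real.rpow_le_rpow hℓ0.le hℓM hδ
  have hℓν : 0 < ℓ ^ ν := Real.rpow_pos_of_pos hℓ0 ν
  have h2pos : (0 : ℝ) ≤ 2 ^ (1 + β) := (Real.rpow_pos_of_pos two_pos _).le
  have h4 : (2 : ℝ) ^ (1 + β) * (ℓ ^ ν * ℓ ^ δ) ≤ 2 ^ (1 + β) * (ℓ ^ ν * M ^ δ) :=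
    mul_le_mul_of_nonneg_left (mul_le_mul_of_nonneg_left h3 hℓν.le) h2pos
  rw [div_le_iff₀ hℓν]
  calc 2 * (ℓ + 1) * ((ℓ + 1) ^ β + b₁ * (ℓ + 1)) + B * (ℓ + 1) ^ 2 * Real.log M
      ≤ (2 + 2 * b₁ + B * Real.log M) * (ℓ + 1) ^ (1 + β) := h1
    _ ≤ (2 + 2 * b₁ + B * Real.log M) * (2 ^ (1 + β) * (ℓ ^ ν * M ^ δ)) :=
        mul_le_mul_of_nonneg_left (h2.trans h4) hKc
    _ = (2 + 2 * b₁ + B * Real.log M) * 2 ^ (1 + β) * M ^ δ * ℓ ^ ν := by ring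

/-- Logarithmic bookkeeping of the window ratio: for `β, b₁, B ≥ 0` and `M ≥ 1`,
`1 + log ((2 + 2 b₁ + B log M) 2^{1+β} M^δ) ≤ 3 + β + 2 b₁ + (B + δ) log M`
(`log x ≤ x - 1`, `log 2 ≤ 1`). -/
theorem soloX_log_ratio_le {β b₁ B M δ : ℝ} (hβ : 0 ≤ β) (hb₁ : 0 ≤ b₁) (hB : 0 ≤ B)
    (hM : 1 ≤ M) :
    1 + Real.log ((2 + 2 * b₁ + B * Real.log M) * 2 ^ (1 + β) * M ^ δ) ≤
      3 + β + 2 * b₁ + (B + δ) * Real.log M := by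
  have hlog : 0 ≤ Real.log M := Real.log_nonneg hM
  have hM0 : 0 < M := by linarith
  have hK : 0 < 2 + 2 * b₁ + B * Real.log M := by nlinarith [mul_nonneg hB hlog]
  have h2 : (0 : ℝ) < 2 ^ (1 + β) := Real.rpow_pos_of_pos two_pos _
  have h3 : 0 < M ^ δ := Real.rpow_pos_of_pos hM0 _
  rw [Real.log_mul (mul_pos hK h2).ne' h3.ne', Real.log_mul hK.ne' h2.ne',
    Real.log_rpow two_pos, Real.log_rpow hM0]
  have l1 : Real.log (2 + 2 * b₁ + B * Real.log M) ≤ 1 + 2 * b₁ + B * Real.log M := by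
    linarith [Real.log_le_sub_one_of_pos hK]
  have l2 : Real.log 2 ≤ 1 := by
    linarith [Real.log_le_sub_one_of_pos (two_pos : (0 : ℝ) < 2)]
  have l3 : (1 + β) * Real.log 2 ≤ 1 + β := mul_le_of_le_one_right (by linarith) l2
  linarith

namespace SoloServiceData

variable {ι : Type*} (D : SoloServiceData ι)

/-! ### One capped cheap main server at one level -/

/-- Late entry (file F5 `entry_gt_of_capped`) of a capped main server alive at `n ≥ n₀`,
in the form used by the count: with `ℓ = entry P n - 1`, `E₀ ≤ ℓ`, `entry P n = ℓ + 1`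
and `entry P n ≤ n`, for every `E₀ ≥ n₀` with
`2 n (E₀^β + b₁ E₀) + B n² log (n+2) < λ n^ν`. -/
theorem good_entry {c₀ β b₁ : ℝ} {n₀ : ℕ} (hW : D ∈ wellFormed c₀)
    (hB : D ∈ budgetLaw β b₁ n₀) (hb₁ : 0 ≤ b₁) (hβ : 0 ≤ β) {B : ℝ} (hBnn : 0 ≤ B)
    {E₀ : ℕ} (hE₀ : n₀ ≤ E₀) {P : ι} {n : ℕ} (hn : n₀ ≤ n) (hP : P ∈ D.alive n) {k : ℕ}
    {lam ν : ℝ} (hsup : lam * (n : ℝ) ^ ν ≤ D.mult P n * D.bank P k)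
    (hcap : D.bank P k ≤ D.cap B P n)
    (hbig : 2 * n * ((E₀ : ℝ) ^ β + b₁ * E₀) + B * (n : ℝ) ^ 2 * Real.log ((n : ℝ) + 2) <
      lam * (n : ℝ) ^ ν) :
    E₀ ≤ D.entry P n - 1 ∧ D.entry P n = (D.entry P n - 1) + 1 ∧ D.entry P n ≤ n := by
  have h1 : E₀ < D.entry P n :=
    D.entry_gt_of_capped hW hB hb₁ hβ hBnn hn hP hsup hcap hE₀ hbig
  have h2 : D.entry P n ≤ n := (D.entry_le_iff_alive P n).mpr hP
  omega

/-- FIBRE SUPPLY (pen §5 (b'), file F5 `deep_of_cheap` + `supply_bound` with `t = 2`):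
a cheap main server `P`, alive at `n`, with entry `ℓ + 1`, `ℓ ≥ E₀ ≥ max n₀ 1`, serving
the nonempty set `S` of columns `k ≤ K ≤ E₀^σ` (`λ n^ν ≤ m d_P^k` on `S`,
`m C_P(n) ≤ η n^ν |S|`, `2η < λ`), has `|S| ℓ^ν ≤ 2 C_P(ℓ)` once
`16 A₂ ℓ^{2-β} log (ℓ+2) ≤ 1`. -/
theorem fibre_supply {c₀ β b₁ σ ν A₂ : ℝ} {n₀ : ℕ} (hW : D ∈ wellFormed c₀)
    (hB : D ∈ budgetLaw β b₁ n₀) (hE : D ∈ entryLaw β σ ν A₂ n₀) (hβ : 0 ≤ β)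
    (hA₂ : 0 ≤ A₂) (hσ : 0 < σ) (hσ1 : σ ≤ 1) {lam η : ℝ} (h2η : 2 * η < lam) {E₀ : ℕ}
    (hE₀ : n₀ ≤ E₀) (hE₁ : 1 ≤ E₀)
    (habs : ∀ ℓ : ℕ, E₀ ≤ ℓ → 16 * A₂ * (ℓ : ℝ) ^ (2 - β) * Real.log ((ℓ : ℝ) + 2) ≤ 1)
    {K : ℕ} (hK : (K : ℝ) ≤ (E₀ : ℝ) ^ σ) {P : ι} {n ℓ : ℕ} (hP : P ∈ D.alive n)
    (hℓ : D.entry P n = ℓ + 1) (hE₀ℓ : E₀ ≤ ℓ) (S : Finset ℕ) (hSne : S.Nonempty)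
    (hS : ∀ k ∈ S, 1 ≤ k ∧ k ≤ K)
    (hsrv : ∀ k ∈ S, lam * (n : ℝ) ^ ν ≤ D.mult P n * D.bank P k)
    (hcheap : (D.mult P n : ℝ) * D.cost β P n ≤ η * (n : ℝ) ^ ν * S.card) :
    (S.card : ℝ) * (ℓ : ℝ) ^ ν ≤ 2 * D.cost β P ℓ := by
  have hℓ0 : n₀ ≤ ℓ := hE₀.trans hE₀ℓ
  have hℓ1 : 1 ≤ ℓ := hE₁.trans hE₀ℓ
  have hℓn : ℓ ≤ n := by have := (D.entry_le_iff_alive P n).mpr hP; omega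
  have hn : 1 ≤ n := hℓ1.trans hℓn
  have hSact := soloX_active_of_le hσ.le hK hE₀ℓ S hS
  have hm : (0 : ℝ) < D.mult P n := lt_of_lt_of_le one_pos (D.one_le_mult_of_alive hW hP)
  have herr := D.entry_error_le' hW hB hA₂ hσ hσ1 hP hℓ hℓ0 hℓ1 S hSact
  have hcost0 : 0 ≤ D.cost β P ℓ :=
    le_trans (Real.rpow_nonneg (Nat.cast_nonneg ℓ) β) (D.rpow_le_cost hW β P ℓ)
  have hT : D.cost β P ℓ + A₂ * ((ℓ : ℝ) + D.deg P + S.card) ^ 2 * Real.log ((ℓ : ℝ) + 2)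
      ≤ 2 * D.cost β P ℓ := by
    have h2 : (1 + 16 * A₂ * (ℓ : ℝ) ^ (2 - β) * Real.log ((ℓ : ℝ) + 2)) * D.cost β P ℓ ≤
        (1 + 1) * D.cost β P ℓ :=
      mul_le_mul_of_nonneg_right (by linarith [habs ℓ hE₀ℓ]) hcost0
    linarith
  have hTn : 2 * D.cost β P ℓ ≤ 2 * D.cost β P n := by linarith [D.cost_mono hW hβ P hℓn]
  have hηt : η * 2 < lam := by linarith
  have hdeep := D.deep_of_cheap hE hℓ hℓ0 hn S hSne hSact (by norm_num : (0 : ℝ) ≤ 2) hηt hm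
    hsrv hT hTn hcheap
  exact D.supply_bound hE hℓ hℓ0 S hSact hm hsrv hdeep.le hT

/-- WINDOW, upper side (pen §5 (b')(1), file F5b `window_upper` with `t = 2`, `m ≥ 1`):
under the hypotheses of `fibre_supply`, `β ≥ 1`, `ν > 1`, `η ≥ 0` and `2η ≤ r^{ν-1}`
(`r = ρ_max`), the level satisfies `ℓ ≤ r n`. -/
theorem fibre_window_upper {c₀ β b₁ σ ν A₂ : ℝ} {n₀ : ℕ} (hW : D ∈ wellFormed c₀)
    (hB : D ∈ budgetLaw β b₁ n₀) (hE : D ∈ entryLaw β σ ν A₂ n₀) (hβ : 1 ≤ β) (hν : 1 < ν)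
    (hA₂ : 0 ≤ A₂) (hσ : 0 < σ) (hσ1 : σ ≤ 1) {lam η : ℝ} (hη : 0 ≤ η) (h2η : 2 * η < lam)
    {r : ℝ} (hr : 0 < r) (hr2 : 2 * η ≤ r ^ (ν - 1)) {E₀ : ℕ} (hE₀ : n₀ ≤ E₀)
    (hE₁ : 1 ≤ E₀)
    (habs : ∀ ℓ : ℕ, E₀ ≤ ℓ → 16 * A₂ * (ℓ : ℝ) ^ (2 - β) * Real.log ((ℓ : ℝ) + 2) ≤ 1)
    {K : ℕ} (hK : (K : ℝ) ≤ (E₀ : ℝ) ^ σ) {P : ι} {n ℓ : ℕ} (hP : P ∈ D.alive n)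
    (hℓ : D.entry P n = ℓ + 1) (hE₀ℓ : E₀ ≤ ℓ) (S : Finset ℕ) (hSne : S.Nonempty)
    (hS : ∀ k ∈ S, 1 ≤ k ∧ k ≤ K)
    (hsrv : ∀ k ∈ S, lam * (n : ℝ) ^ ν ≤ D.mult P n * D.bank P k)
    (hcheap : (D.mult P n : ℝ) * D.cost β P n ≤ η * (n : ℝ) ^ ν * S.card) :
    (ℓ : ℝ) ≤ r * n := by
  have hℓ1 : 1 ≤ ℓ := hE₁.trans hE₀ℓ
  have hℓn : ℓ ≤ n := by have := (D.entry_le_iff_alive P n).mpr hP; omega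
  have hℓpos : (0 : ℝ) < ℓ := by exact_mod_cast hℓ1
  have hnpos : (0 : ℝ) < n := by exact_mod_cast hℓ1.trans hℓn
  have hsupply := D.fibre_supply hW hB hE (le_trans zero_le_one hβ) hA₂ hσ hσ1 h2η hE₀ hE₁
    habs hK hP hℓ hE₀ℓ S hSne hS hsrv hcheap
  have hwu := D.window_upper hW hβ hℓ1 hℓn S hη hsupply (le_refl (2 * D.cost β P ℓ)) hcheap
  have hm1 : (1 : ℝ) ≤ D.mult P n := D.one_le_mult_of_alive hW hP
  have hnℓ : (n : ℝ) * (ℓ : ℝ) ^ ν ≤ η * 2 * ℓ * (n : ℝ) ^ ν := by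
    have h0 : (0 : ℝ) ≤ (n : ℝ) * (ℓ : ℝ) ^ ν := by positivity
    nlinarith [mul_le_mul_of_nonneg_left hm1 h0]
  have eℓ : (ℓ : ℝ) ^ ν = (ℓ : ℝ) ^ (ν - 1) * ℓ := by
    rw [← Real.rpow_add_one hℓpos.ne', sub_add_cancel]
  have en : (n : ℝ) ^ ν = (n : ℝ) ^ (ν - 1) * n := by
    rw [← Real.rpow_add_one hnpos.ne', sub_add_cancel]
  rw [eℓ, en] at hnℓ
  have h3 : (ℓ : ℝ) ^ (ν - 1) ≤ 2 * η * (n : ℝ) ^ (ν - 1) := by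
    have h : (ℓ : ℝ) ^ (ν - 1) * ((n : ℝ) * ℓ) ≤ 2 * η * (n : ℝ) ^ (ν - 1) * ((n : ℝ) * ℓ) := by
      linarith
    exact le_of_mul_le_mul_right h (mul_pos hnpos hℓpos)
  have h4 : (ℓ : ℝ) ^ (ν - 1) ≤ (r * n) ^ (ν - 1) := by
    rw [Real.mul_rpow hr.le hnpos.le]
    have : 2 * η * (n : ℝ) ^ (ν - 1) ≤ r ^ (ν - 1) * (n : ℝ) ^ (ν - 1) :=
      mul_le_mul_of_nonneg_right hr2 (by positivity)
    linarith
  exact (Real.rpow_le_rpow_iff hℓpos.le (by positivity) (by linarith : 0 < ν - 1)).mp h4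

/-- WINDOW, lower side (pen §5 (b')(2), file F5b `window_lower` with `t = 2`, and file F5
`cap_le_entry`): under the hypotheses of `fibre_supply`, with `λ > 0`, `η, b₁, B ≥ 0`,
`β ≥ 1`, a CAPPED assigned column `k ∈ S` and `n + 2 ≤ M`,
`λ n ℓ^{ν-1} ≤ 2η U(ℓ+1)`, `U(e) = 2 e (e^β + b₁ e) + B e² log M`. -/
theorem fibre_window_lower {c₀ β b₁ σ ν A₂ : ℝ} {n₀ : ℕ} (hW : D ∈ wellFormed c₀)
    (hB : D ∈ budgetLaw β b₁ n₀) (hE : D ∈ entryLaw β σ ν A₂ n₀)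
    (hβ : 1 ≤ β) (hA₂ : 0 ≤ A₂) (hσ : 0 < σ) (hσ1 : σ ≤ 1) {B : ℝ} (hBnn : 0 ≤ B)
    {lam η : ℝ} (hlam : 0 < lam) (hη : 0 ≤ η) (h2η : 2 * η < lam) {E₀ : ℕ} (hE₀ : n₀ ≤ E₀)
    (hE₁ : 1 ≤ E₀)
    (habs : ∀ ℓ : ℕ, E₀ ≤ ℓ → 16 * A₂ * (ℓ : ℝ) ^ (2 - β) * Real.log ((ℓ : ℝ) + 2) ≤ 1)
    {K : ℕ} (hK : (K : ℝ) ≤ (E₀ : ℝ) ^ σ) {P : ι} {n ℓ : ℕ} (hP : P ∈ D.alive n)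
    (hℓ : D.entry P n = ℓ + 1) (hE₀ℓ : E₀ ≤ ℓ) (S : Finset ℕ)
    (hS : ∀ k ∈ S, 1 ≤ k ∧ k ≤ K)
    (hsrv : ∀ k ∈ S, lam * (n : ℝ) ^ ν ≤ D.mult P n * D.bank P k)
    (hcheap : (D.mult P n : ℝ) * D.cost β P n ≤ η * (n : ℝ) ^ ν * S.card) {k : ℕ}
    (hk : k ∈ S) (hcap : D.bank P k ≤ D.cap B P n) {M : ℝ} (hM : (n : ℝ) + 2 ≤ M) :
    lam * n * (ℓ : ℝ) ^ (ν - 1) ≤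
      2 * η * (2 * ((ℓ : ℝ) + 1) * (((ℓ : ℝ) + 1) ^ β + b₁ * ((ℓ : ℝ) + 1)) +
        B * ((ℓ : ℝ) + 1) ^ 2 * Real.log M) := by
  have hSne : S.Nonempty := ⟨k, hk⟩
  have hℓ0 : n₀ ≤ ℓ := hE₀.trans hE₀ℓ
  have hℓ1 : 1 ≤ ℓ := hE₁.trans hE₀ℓ
  have hℓn : ℓ ≤ n := by have := (D.entry_le_iff_alive P n).mpr hP; omega
  have hn : 1 ≤ n := hℓ1.trans hℓn
  have hℓpos : (0 : ℝ) < ℓ := by exact_mod_cast hℓ1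
  have hm : (0 : ℝ) < D.mult P n := lt_of_lt_of_le one_pos (D.one_le_mult_of_alive hW hP)
  have hsupply := D.fibre_supply hW hB hE (le_trans zero_le_one hβ) hA₂ hσ hσ1 h2η hE₀ hE₁
    habs hK hP hℓ hE₀ℓ S hSne hS hsrv hcheap
  have hwu := D.window_upper hW hβ hℓ1 hℓn S hη hsupply (le_refl (2 * D.cost β P ℓ)) hcheap
  have hU' := D.cap_le_entry hW hB hBnn hP (by omega : n₀ ≤ D.entry P n)
  rw [hℓ] at hU'
  push_cast at hU'
  have hlogM : Real.log ((n : ℝ) + 2) ≤ Real.log M := Real.log_le_log (by positivity) hM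
  have hU : D.cap B P n ≤ 2 * ((ℓ : ℝ) + 1) * (((ℓ : ℝ) + 1) ^ β + b₁ * ((ℓ : ℝ) + 1)) +
      B * ((ℓ : ℝ) + 1) ^ 2 * Real.log M := by
    have := mul_le_mul_of_nonneg_left hlogM (by positivity : 0 ≤ B * ((ℓ : ℝ) + 1) ^ 2)
    linarith
  have hwl := D.window_lower hn hlam hm (hsrv k hk) hcap hU hwu
  have eℓ : (ℓ : ℝ) ^ ν = (ℓ : ℝ) ^ (ν - 1) * ℓ := by
    rw [← Real.rpow_add_one hℓpos.ne', sub_add_cancel]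
  rw [eℓ] at hwl
  have h : lam * n * (ℓ : ℝ) ^ (ν - 1) * ℓ ≤
      2 * η * (2 * ((ℓ : ℝ) + 1) * (((ℓ : ℝ) + 1) ^ β + b₁ * ((ℓ : ℝ) + 1)) +
        B * ((ℓ : ℝ) + 1) ^ 2 * Real.log M) * ℓ := by
    linarith
  exact le_of_mul_le_mul_right h hℓpos

section Lives

variable [DecidableEq ι]

/-! ### Good columns at one level: the fibre of a server -/

/-- The fibre of a good column `k ∈ G ⊆ [1, K]` (the columns of `G` with the same server
`P = srv k`): it contains `k`, consists of columns `≤ K`, and `P` main-serves every column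
of it with a capped bank. -/
theorem good_fibre {lam ν β B η : ℝ} {K n : ℕ} {G : Finset ℕ} (hGK : G ⊆ Finset.Icc 1 K)
    {srv : ℕ → ι}
    (hgood : ∀ k ∈ G, srv k ∈ D.alive n ∧
      lam * (n : ℝ) ^ ν ≤ D.mult (srv k) n * D.bank (srv k) k ∧
      D.bank (srv k) k ≤ D.cap B (srv k) n ∧
      (D.mult (srv k) n : ℝ) * D.cost β (srv k) n ≤
        η * (n : ℝ) ^ ν * (G.filter (fun k' => srv k' = srv k)).card)
    {k : ℕ} (hk : k ∈ G) :
    k ∈ G.filter (fun k' => srv k' = srv k) ∧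
    (∀ k' ∈ G.filter (fun k' => srv k' = srv k), 1 ≤ k' ∧ k' ≤ K) ∧
    (∀ k' ∈ G.filter (fun k' => srv k' = srv k),
      lam * (n : ℝ) ^ ν ≤ D.mult (srv k) n * D.bank (srv k) k' ∧
      D.bank (srv k) k' ≤ D.cap B (srv k) n) := by
  refine ⟨Finset.mem_filter.mpr ⟨hk, rfl⟩, fun k' hk' => ?_, fun k' hk' => ?_⟩
  · have h := hGK (Finset.mem_filter.mp hk').1
    rw [Finset.mem_Icc] at h
    exact h
  · have hk'G : k' ∈ G := (Finset.mem_filter.mp hk').1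
    have hk'e : srv k' = srv k := (Finset.mem_filter.mp hk').2
    obtain ⟨-, h2, h3, -⟩ := hgood k' hk'G
    rw [hk'e] at h2 h3
    exact ⟨h2, h3⟩

/-- A good column's server at a level `n ≥ n₀` of the count (`good_entry` and
`fibre_supply` on its fibre): entry `ℓ + 1` with `E₀ ≤ ℓ = entry - 1`, `entry ≤ n`, and
the fibre supply `|fibre| ℓ^ν ≤ 2 C_P(ℓ)`. -/
theorem good_server {c₀ β b₁ σ ν A₂ : ℝ} {n₀ : ℕ} (hW : D ∈ wellFormed c₀)
    (hB : D ∈ budgetLaw β b₁ n₀) (hE : D ∈ entryLaw β σ ν A₂ n₀) (hb₁ : 0 ≤ b₁)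
    (hβ : 0 ≤ β) (hA₂ : 0 ≤ A₂) (hσ : 0 < σ) (hσ1 : σ ≤ 1) {B : ℝ} (hBnn : 0 ≤ B)
    {lam η : ℝ} (h2η : 2 * η < lam) {E₀ : ℕ} (hE₀ : n₀ ≤ E₀) (hE₁ : 1 ≤ E₀)
    (habs : ∀ ℓ : ℕ, E₀ ≤ ℓ → 16 * A₂ * (ℓ : ℝ) ^ (2 - β) * Real.log ((ℓ : ℝ) + 2) ≤ 1)
    {K : ℕ} (hK : (K : ℝ) ≤ (E₀ : ℝ) ^ σ) {n : ℕ} (hn : n₀ ≤ n)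
    (hbig : 2 * n * ((E₀ : ℝ) ^ β + b₁ * E₀) + B * (n : ℝ) ^ 2 * Real.log ((n : ℝ) + 2) <
      lam * (n : ℝ) ^ ν)
    {G : Finset ℕ} (hGK : G ⊆ Finset.Icc 1 K) {srv : ℕ → ι}
    (hgood : ∀ k ∈ G, srv k ∈ D.alive n ∧
      lam * (n : ℝ) ^ ν ≤ D.mult (srv k) n * D.bank (srv k) k ∧
      D.bank (srv k) k ≤ D.cap B (srv k) n ∧
      (D.mult (srv k) n : ℝ) * D.cost β (srv k) n ≤
        η * (n : ℝ) ^ ν * (G.filter (fun k' => srv k' = srv k)).card)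
    {k : ℕ} (hk : k ∈ G) :
    E₀ ≤ D.entry (srv k) n - 1 ∧ D.entry (srv k) n = (D.entry (srv k) n - 1) + 1 ∧
    D.entry (srv k) n ≤ n ∧
    ((G.filter (fun k' => srv k' = srv k)).card : ℝ) *
        ((D.entry (srv k) n - 1 : ℕ) : ℝ) ^ ν ≤
      2 * D.cost β (srv k) (D.entry (srv k) n - 1) := by
  obtain ⟨hP, hsup, hcap, hcheap⟩ := hgood k hk
  obtain ⟨hkS, hS, hsrvS⟩ := D.good_fibre hGK hgood hk
  obtain ⟨h1, h2, h3⟩ := D.good_entry hW hB hb₁ hβ hBnn hE₀ hn hP hsup hcap hbig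
  exact ⟨h1, h2, h3, D.fibre_supply hW hB hE hβ hA₂ hσ hσ1 h2η hE₀ hE₁ habs hK hP h2 h1 _
    ⟨k, hkS⟩ hS (fun k' hk' => (hsrvS k' hk').1) hcheap⟩

/-- The upper side of the window for a good column's server (`fibre_window_upper` on the
fibre): `entry - 1 ≤ r n` whenever `2η ≤ r^{ν-1}`, `β ≥ 1`, `ν > 1`. -/
theorem good_window_upper {c₀ β b₁ σ ν A₂ : ℝ} {n₀ : ℕ} (hW : D ∈ wellFormed c₀)
    (hB : D ∈ budgetLaw β b₁ n₀) (hE : D ∈ entryLaw β σ ν A₂ n₀) (hb₁ : 0 ≤ b₁)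
    (hβ : 1 ≤ β) (hν : 1 < ν) (hA₂ : 0 ≤ A₂) (hσ : 0 < σ) (hσ1 : σ ≤ 1) {B : ℝ}
    (hBnn : 0 ≤ B) {lam η : ℝ} (hη : 0 ≤ η) (h2η : 2 * η < lam) {r : ℝ} (hr : 0 < r)
    (hr2 : 2 * η ≤ r ^ (ν - 1)) {E₀ : ℕ} (hE₀ : n₀ ≤ E₀) (hE₁ : 1 ≤ E₀)
    (habs : ∀ ℓ : ℕ, E₀ ≤ ℓ → 16 * A₂ * (ℓ : ℝ) ^ (2 - β) * Real.log ((ℓ : ℝ) + 2) ≤ 1)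
    {K : ℕ} (hK : (K : ℝ) ≤ (E₀ : ℝ) ^ σ) {n : ℕ} (hn : n₀ ≤ n)
    (hbig : 2 * n * ((E₀ : ℝ) ^ β + b₁ * E₀) + B * (n : ℝ) ^ 2 * Real.log ((n : ℝ) + 2) <
      lam * (n : ℝ) ^ ν)
    {G : Finset ℕ} (hGK : G ⊆ Finset.Icc 1 K) {srv : ℕ → ι}
    (hgood : ∀ k ∈ G, srv k ∈ D.alive n ∧
      lam * (n : ℝ) ^ ν ≤ D.mult (srv k) n * D.bank (srv k) k ∧
      D.bank (srv k) k ≤ D.cap B (srv k) n ∧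
      (D.mult (srv k) n : ℝ) * D.cost β (srv k) n ≤
        η * (n : ℝ) ^ ν * (G.filter (fun k' => srv k' = srv k)).card)
    {k : ℕ} (hk : k ∈ G) :
    ((D.entry (srv k) n - 1 : ℕ) : ℝ) ≤ r * n := by
  obtain ⟨hP, hsup, hcap, hcheap⟩ := hgood k hk
  obtain ⟨hkS, hS, hsrvS⟩ := D.good_fibre hGK hgood hk
  obtain ⟨h1, h2, -⟩ :=
    D.good_entry hW hB hb₁ (le_trans zero_le_one hβ) hBnn hE₀ hn hP hsup hcap hbig
  exact D.fibre_window_upper hW hB hE hβ hν hA₂ hσ hσ1 hη h2η hr hr2 hE₀ hE₁ habs hK hP h2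
    h1 _ ⟨k, hkS⟩ hS (fun k' hk' => (hsrvS k' hk').1) hcheap

/-- The lower side of the window for a good column's server (`fibre_window_lower` on the
fibre, the column itself being capped): `λ n ℓ^{ν-1} ≤ 2η U(ℓ+1)` with `ℓ = entry - 1`,
for any `M ≥ n + 2`. -/
theorem good_window_lower {c₀ β b₁ σ ν A₂ : ℝ} {n₀ : ℕ} (hW : D ∈ wellFormed c₀)
    (hB : D ∈ budgetLaw β b₁ n₀) (hE : D ∈ entryLaw β σ ν A₂ n₀) (hb₁ : 0 ≤ b₁)
    (hβ : 1 ≤ β) (hA₂ : 0 ≤ A₂) (hσ : 0 < σ) (hσ1 : σ ≤ 1) {B : ℝ} (hBnn : 0 ≤ B)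
    {lam η : ℝ} (hη : 0 ≤ η) (h2η : 2 * η < lam) {E₀ : ℕ} (hE₀ : n₀ ≤ E₀)
    (hE₁ : 1 ≤ E₀)
    (habs : ∀ ℓ : ℕ, E₀ ≤ ℓ → 16 * A₂ * (ℓ : ℝ) ^ (2 - β) * Real.log ((ℓ : ℝ) + 2) ≤ 1)
    {K : ℕ} (hK : (K : ℝ) ≤ (E₀ : ℝ) ^ σ) {n : ℕ} (hn : n₀ ≤ n) {M : ℝ}
    (hM : (n : ℝ) + 2 ≤ M)
    (hbig : 2 * n * ((E₀ : ℝ) ^ β + b₁ * E₀) + B * (n : ℝ) ^ 2 * Real.log ((n : ℝ) + 2) <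
      lam * (n : ℝ) ^ ν)
    {G : Finset ℕ} (hGK : G ⊆ Finset.Icc 1 K) {srv : ℕ → ι}
    (hgood : ∀ k ∈ G, srv k ∈ D.alive n ∧
      lam * (n : ℝ) ^ ν ≤ D.mult (srv k) n * D.bank (srv k) k ∧
      D.bank (srv k) k ≤ D.cap B (srv k) n ∧
      (D.mult (srv k) n : ℝ) * D.cost β (srv k) n ≤
        η * (n : ℝ) ^ ν * (G.filter (fun k' => srv k' = srv k)).card)
    {k : ℕ} (hk : k ∈ G) :
    lam * n * ((D.entry (srv k) n - 1 : ℕ) : ℝ) ^ (ν - 1) ≤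
      2 * η * (2 * (((D.entry (srv k) n - 1 : ℕ) : ℝ) + 1) *
        ((((D.entry (srv k) n - 1 : ℕ) : ℝ) + 1) ^ β +
          b₁ * (((D.entry (srv k) n - 1 : ℕ) : ℝ) + 1)) +
        B * (((D.entry (srv k) n - 1 : ℕ) : ℝ) + 1) ^ 2 * Real.log M) := by
  have hlam : 0 < lam := by linarith
  obtain ⟨hP, hsup, hcap, hcheap⟩ := hgood k hk
  obtain ⟨hkS, hS, hsrvS⟩ := D.good_fibre hGK hgood hk
  obtain ⟨h1, h2, -⟩ :=
    D.good_entry hW hB hb₁ (le_trans zero_le_one hβ) hBnn hE₀ hn hP hsup hcap hbig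
  exact D.fibre_window_lower hW hB hE hβ hA₂ hσ hσ1 hBnn hlam hη h2η hE₀ hE₁ habs hK hP h2
    h1 _ hS (fun k' hk' => (hsrvS k' hk').1) hcheap hkS hcap hM

end Lives

end SoloServiceData

end Summit.Schanuel.Schanuel.Theorems
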